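import Summits.RiemannHypothesis.RiemannHypothesis.Theses.WeilGroundState
import Summits.RiemannHypothesis.RiemannHypothesis.Theorems.WeilGroundStateGroundStatesConvergeToXiStubPsiDecay
import Summits.RiemannHypothesis.RiemannHypothesis.Theorems.WeilGroundStateGroundStatesConvergeToXiStubMellinXi
import Summits.RiemannHypothesis.RiemannHypothesis.Theorems.WeilGroundStateGroundStatesConvergeToXiStubPointwiseOfWeak
import Summits.RiemannHypothesis.RiemannHypothesis.Theorems.WeilGroundStateGroundStatesConvergeToXiStubLocallyUniformOfPointwise
import Summits.RiemannHypothesis.RiemannHypothesis.Theorems.WeilGroundStateGroundStatesConvergeToXiStubPointwiseOfTightMoments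
import Summits.RiemannHypothesis.RiemannHypothesis.Theorems.WeilGroundStateGroundStatesConvergeToXiStubMomentsOfStrip
import Summits.RiemannHypothesis.RiemannHypothesis.Theorems.WeilGroundStateGroundStatesConvergeToXiLineExact
import Summits.RiemannHypothesis.RiemannHypothesis.Theorems.WeilGroundStateGroundStatesConvergeToXiTransfer
import Summits.RiemannHypothesis.RiemannHypothesis.Theorems.WeilGroundStateGroundStatesConvergeToXiRHofTightZero
import Summits.RiemannHypothesis.RiemannHypothesis.Theorems.WeilGroundStateGroundStatesConvergeToXiStubRePartGroundState
import Summits.RiemannHypothesis.RiemannHypothesis.Theorems.WeilGroundStateGroundStatesConvergeToXiStubEvenWitnessTight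
import Summits.RiemannHypothesis.RiemannHypothesis.Theorems.WeilGroundStateGroundStatesConvergeToXiStubRealWitnessTight
import Summits.RiemannHypothesis.RiemannHypothesis.Theorems.WeilGroundStateGroundStatesConvergeToXiStubEnergyCauchy
import Summits.RiemannHypothesis.RiemannHypothesis.Theorems.WeilGroundStateGroundStatesConvergeToXiZeroSideEulerLagrange
import Summits.RiemannHypothesis.RiemannHypothesis.Theorems.WeilGroundStateGroundStatesConvergeToXiStubSaturationOfRH
import Summits.RiemannHypothesis.RiemannHypothesis.Theorems.WeilGroundStateGroundStatesConvergeToXiRealNormalForm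
import Summits.RiemannHypothesis.RiemannHypothesis.Theorems.WeilGroundStateGroundStatesConvergeToXiNegativePart
import Summits.RiemannHypothesis.RiemannHypothesis.Theorems.WeilGroundStateGroundStatesConvergeToXiStubBoxSobolev
import Summits.RiemannHypothesis.RiemannHypothesis.Theorems.WeilGroundStateGroundStatesConvergeToXiStubPlancherelBudget
import Summits.RiemannHypothesis.RiemannHypothesis.Theorems.WeilGroundStateGroundStatesConvergeToXiStubZeroWindowCount
import Summits.RiemannHypothesis.RiemannHypothesis.Theorems.WeilGroundStateGroundStatesConvergeToXiStubZeroSampling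
import Summits.RiemannHypothesis.RiemannHypothesis.Theorems.WeilGroundStateGroundStatesConvergeToXiStubInterpolation
import Summits.RiemannHypothesis.RiemannHypothesis.Theorems.WeilGroundStateGroundStatesConvergeToXiStubDirichletEnergyMul
import Summits.RiemannHypothesis.RiemannHypothesis.Theorems.WeilGroundStateGroundStatesConvergeToXiStubLogPlancherel
import Summits.RiemannHypothesis.RiemannHypothesis.Theorems.WeilGroundStateGroundStatesConvergeToXiStubLogWeightedAssembly
import Summits.RiemannHypothesis.RiemannHypothesis.Theorems.WeilGroundStateGroundStatesConvergeToXiStubWeightedLineBudget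
import Summits.RiemannHypothesis.RiemannHypothesis.Theorems.WeilGroundStateGroundStatesConvergeToXiStubFormBoundedSampling
import Summits.RiemannHypothesis.RiemannHypothesis.Theorems.WeilGroundStateGroundStatesConvergeToXiStubSamplingCauchy
import Summits.RiemannHypothesis.RiemannHypothesis.Theorems.WeilGroundStateGroundStatesConvergeToXiStubZeroSideEnergy
import Summits.RiemannHypothesis.RiemannHypothesis.Theorems.WeilGroundStateGroundStatesConvergeToXiZeroSideDefect
import Summits.RiemannHypothesis.RiemannHypothesis.Theorems.WeilGroundStateGroundStatesConvergeToXiMellinByParts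
import Summits.RiemannHypothesis.RiemannHypothesis.Theorems.WeilGroundStateGroundStatesConvergeToXiPhiTail
import Summits.RiemannHypothesis.RiemannHypothesis.Theorems.WeilGroundStateGroundStatesConvergeToXiCutoff
import Summits.RiemannHypothesis.RiemannHypothesis.Theorems.WeilGroundStateGroundStatesConvergeToXiEnergyUpperTail
import Summits.RiemannHypothesis.RiemannHypothesis.Theorems.WeilGroundStateGroundStatesConvergeToXiStubZeroSideTruncation
import Summits.RiemannHypothesis.RiemannHypothesis.Theorems.WeilGroundStateGroundStatesConvergeToXiStubPrimeTermTruncation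
import Summits.RiemannHypothesis.RiemannHypothesis.Theorems.WeilGroundStateGroundStatesConvergeToXiStubArchPolarTruncation
import Summits.RiemannHypothesis.RiemannHypothesis.Theorems.WeilGroundStateGroundStatesConvergeToXiStubArchBombieriTruncation
import Summits.RiemannHypothesis.RiemannHypothesis.Theorems.WeilGroundStateGroundStatesConvergeToXiStubPhiTranslateHarmonic
import Summits.RiemannHypothesis.RiemannHypothesis.Theorems.WeilGroundStateGroundStatesConvergeToXiStubPhiConvHarmonic
import Summits.RiemannHypothesis.RiemannHypothesis.Theorems.WeilGroundStateGroundStatesConvergeToXiExpClassHarmonic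
import Summits.RiemannHypothesis.RiemannHypothesis.Theorems.WeilGroundStateGroundStatesConvergeToXiDoobIdentity
import Summits.RiemannHypothesis.RiemannHypothesis.Theorems.WeilGroundStateGroundStatesConvergeToXiStubDoobPrime
import Summits.RiemannHypothesis.RiemannHypothesis.Theorems.WeilGroundStateGroundStatesConvergeToXiStubDoobArch
import Summits.RiemannHypothesis.RiemannHypothesis.Theorems.WeilGroundStateGroundStatesConvergeToXiStubDoobPolar
import Summits.RiemannHypothesis.RiemannHypothesis.Theorems.WeilGroundStateGroundStatesConvergeToXiStubGaussianExpClass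
import Summits.RiemannHypothesis.RiemannHypothesis.Theorems.WeilGroundStateGroundStatesConvergeToXiStubDoobKernelSign
import Summits.RiemannHypothesis.RiemannHypothesis.Theorems.WeilGroundStateGroundStatesConvergeToXiStubTightWeakOfWeightedL2Limit
import Summits.RiemannHypothesis.RiemannHypothesis.Theorems.WeilGroundStateGroundStatesConvergeToXiStubWeilGroundEnergyDoob
import Summits.RiemannHypothesis.RiemannHypothesis.Theorems.WeilGroundStateGroundStatesConvergeToXiStubDoobLongRange
import Summits.RiemannHypothesis.RiemannHypothesis.Theorems.WeilGroundStateGroundStatesConvergeToXiStubDoobBulkPoincare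
import Summits.RiemannHypothesis.RiemannHypothesis.Theorems.WeilGroundStateGroundStatesConvergeToXiStubPhiIteratedDerivEnvelope
import Summits.RiemannHypothesis.RiemannHypothesis.Theorems.WeilGroundStateGroundStatesConvergeToXiStubMellinDivide
import Summits.RiemannHypothesis.RiemannHypothesis.Theorems.WeilGroundStateGroundStatesConvergeToXiStubStrongClassPairing
import Summits.RiemannHypothesis.RiemannHypothesis.Theorems.WeilGroundStateGroundStatesConvergeToXiStubMellinDivideStrong
import Summits.RiemannHypothesis.RiemannHypothesis.Theorems.WeilGroundStateGroundStatesConvergeToXiStubHarmonicExtension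
import Summits.RiemannHypothesis.RiemannHypothesis.Theorems.WeilGroundStateGroundStatesConvergeToXiStubPhiDivideIterate
import Summits.RiemannHypothesis.RiemannHypothesis.Theorems.WeilGroundStateGroundStatesConvergeToXiHarmonicClosure
import Summits.RiemannHypothesis.RiemannHypothesis.Theorems.WeilGroundStateGroundStatesConvergeToXiStubWeilArchPolarDominated
import Summits.RiemannHypothesis.RiemannHypothesis.Theorems.WeilGroundStateGroundStatesConvergeToXiStubWeilFunctionalDominated
import Summits.RiemannHypothesis.RiemannHypothesis.Theorems.WeilGroundStateGroundStatesConvergeToXiStubWeilConvPairing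
import Summits.RiemannHypothesis.RiemannHypothesis.Theorems.WeilGroundStateGroundStatesConvergeToXiStubGroundStateEulerLagrangeStrong
import Summits.RiemannHypothesis.RiemannHypothesis.Theorems.WeilGroundStateGroundStatesConvergeToXiStubWeightedL1OfWeakLimit
import Summits.RiemannHypothesis.RiemannHypothesis.Theorems.WeilGroundStateGroundStatesConvergeToXiStubPhiTranslateAvgHarmonic
import Summits.RiemannHypothesis.RiemannHypothesis.Theorems.WeilGroundStateGroundStatesConvergeToXiWeakLimitHarmonic
import Summits.RiemannHypothesis.RiemannHypothesis.Theorems.WeilGroundStateGroundStatesConvergeToXiStubWeakLimitMellinPointwise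
import Summits.RiemannHypothesis.RiemannHypothesis.Theorems.WeilGroundStateGroundStatesConvergeToXiStubWeakLimitMellinLocallyUniform
import Summits.RiemannHypothesis.RiemannHypothesis.Theorems.WeilGroundStateGroundStatesConvergeToXiWeakLimitMellin
import Literature.NumberTheory.LFunctions.WeilExplicit
import Literature.NumberTheory.LFunctions.WeilExplicitProofs
import Literature.NumberTheory.LFunctions.WeilExplicitFormulaProofs
import Literature.NumberTheory.LFunctions.WeilExplicitArchTermProofs
import Literature.NumberTheory.LFunctions.WeilZeroSum
import Literature.NumberTheory.LFunctions.ZetaZeroReciprocalSum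
import Literature.NumberTheory.LFunctions.WeilGroundState
import Literature.NumberTheory.LFunctions.WeilMarkovQuadratic
import Literature.NumberTheory.LFunctions.ZetaZerosJensen
import Literature.NumberTheory.LFunctions.RiemannXi
import Literature.NumberTheory.LFunctions.RiemannXiFourier
import Literature.Analysis.Complex.VitaliConvergence
import Literature.Analysis.Calculus.SmoothCutoff
import HarnessLib.Audit

/-!
# `WeilGroundState.GroundStatesConvergeToXi` — line `Sketch` (lead skeleton, rev L11 — continuation lead c9)
(crux item stmt-RiemannHypothesis-1527, route route-RiemannHypothesis-WeilGroundState)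

Rev L11 (lead prover-line-stmt-RiemannHypothesis-1527-c9-0, 2026-08-17): **RESHAPE — TIGHT WEAK
LIMITS OF RENORMALISED GROUND STATES ARE WEIL-HARMONIC (RH-free) and NON-RIGIDITY OF THE HARMONIC
CLASS; same transfer architecture, same open stub.**  The composition `GroundStatesConvergeToXi_of`
is unchanged (one load-bearing open stub, `stub_tightMomentLimit_real` = A_real, ≥ RH, the lead's,
STUCK by design).  Six RH-free registered stubs (wave 1) complete the first lemma of card
`harmonic-weak-limit-closure` (`HarmonicWeakLimitClosure`), whose Mellin half (`harmonic_closure`,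
rev L10g) and RH half (`riemannHypothesis_of_tight_weakLimit_ne_zero`, c0) are in the tree, by
supplying the missing VARIATIONAL half — every `b₀ > 1/2`-tight weak limit `v` of `c_k u_k`
(ground states `u_k` at windows `a_k → ∞`) is annihilated by Weil's functional, `W(v ⋆ g̃) = 0` for
all tests `g`:
* `stub_weilArchPolar_dominated` (H1) + `stub_weilFunctional_dominated` (H2): the Weil functional is
  continuous on the exponential Weil class under DOMINATED POINTWISE convergence (common envelope
  `‖F_k‖,‖F_k'‖,‖F_k''‖ ≤ C e^{-b₀|t|}`, `b₀ > 1/2`; Tannery on the prime side, dominated convergence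
  on the polar side and — through the uniform `K/(1+t²)` Mellin bound of `…MellinByParts` — on the
  digamma side); the rev-L10 truncation lemmas W12b/W12c are the special case `F_R = f·χ_R`.
* `stub_weilConv_pairing` (H3): `f ↦ f ⋆ h̃` is bounded from weighted `L¹(e^{b₁|t|})` into every
  seminorm of the class with constants independent of `f` (so `{c_k u_k ⋆ h̃}_k` has a COMMON
  envelope), and weak convergence against tests gives pointwise convergence of the convolutions.
* `stub_groundState_eulerLagrange_strong` (H4): the weak Euler–Lagrange equation for the ground
  state itself, `W(u ⋆ h̃) = ε(a)⟨u, h⟩` (Bombieri 2000 (4.2); from `groundState_eulerLagrange` along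
  the minimising sequence + H2 + H3).
* `stub_weightedL1_of_weakLimit` (H5): weighted `L¹` norms are weakly lower semicontinuous (removes
  the integrability hypothesis on the limit).
* `stub_phi_translateAvg_harmonic` (H6): the NON-RIGIDITY WITNESS `v_x = (τ_xΦ + τ_{-x}Φ)/2`:
  real, even, positive, Schwartz-exponential, Weil-harmonic, `v̂_x = cosh((s-½)x)ξ(s)` (extra zeros
  on the critical line only), not a multiple of `Φ` for `x ≠ 0`.
Glue (lead file `…WeakLimitHarmonic.lean`): `weakLimit_harmonic` (H1–H4 + the RH-free energy
dichotomy `tendsto_weilGroundEnergy_zero_or_atBot`: if `ε → 0` the limit of the Euler–Lagrange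
identities is `W(v ⋆ h̃) = 0·⟨v, h⟩`; if `ε → -∞` then `¬RH`, every pairing `⟨c_k u_k, g⟩` tends to
`0` by c0's theorem, `v = 0` a.e. and `W(0) = 0`), `weakLimit_weilMellin_eq_zero` (∘ `harmonic_closure`:
`v̂(ρ) = 0` at EVERY non-trivial zero), the dichotomy `v = 0 a.e. ∨ (RH ∧ ε → 0 ∧ v harmonic)`, and
`exists_weilHarmonic_not_const_mul_phi` (H6).  Bearing on A_real: after rev L11 the crux factors
RH-free as NV (a non-zero `b₀>1/2`-tight weak limit exists; ⇒ RH) × IDENT (that limit is `c·Φ`);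
H6 shows IDENT is not a consequence of any property of the limit visible to the explicit formula
(harmonicity, parity, positivity, decay, zero location) — it must come from finite-window
minimality (CCM25 §8 step 2), which is where A_real stays STUCK.

Rev L10 (lead prover-line-stmt-RiemannHypothesis-1527-c8-0, 2026-08-17): **RESHAPE — the EXPLICIT
FORMULA FOR THE EXPONENTIAL WEIL CLASS and WEIL-HARMONICITY OF RIEMANN'S KERNEL (RH-free), same
transfer architecture, same open stub.**  The composition `GroundStatesConvergeToXi_of` is unchanged
(one load-bearing open stub, `stub_tightMomentLimit_real` = A_real, ≥ RH, the lead's, STUCK by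
design).  Six RH-free registered stubs supply the structural identity behind the crux's limit object
that the tree lacks: Riemann's kernel `Φ(t) = 2Ψ(2t)` (`Φ̂ = ξ`, `stub_mellinXi`) is annihilated by
Weil's functional, unconditionally (`ξ(ρ) = 0` at EVERY non-trivial zero, on the line or not) —
the first lemma of the crux idea cards `xi-kernel-doob-transform` / `harmonic-weak-limit-closure`
(numerically certified to `3.9e-21`, job j015519, never proved).  Since `Φ` is not compactly
supported this needs the explicit formula beyond the tree's `explicit_formula_holds` (test functions
= smooth of COMPACT support): for the EXPONENTIAL WEIL CLASS — smooth `f` with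
`‖f‖, ‖f'‖, ‖f''‖ ≤ C e^{-b₀|t|}`, `b₀ > 1/2` (Weil 1952's class `W_{b₀}` up to smoothness; contains
the Gaussians, `Φ`, its translates and `Φ ⋆ g̃`) — by plateau truncation `f_R = f · cutoff R`
(`Literature.Analysis.Calculus.cutoff`: `= 1` on `[-(R-1), R-1]`, `= 0` off `(-R, R)`) and dominated
convergence on each side of the formula:
* `stub_zeroSide_truncation` (W12a): `Σ_ρ ‖m(ρ) f̂(ρ)‖ < ∞` and `Σ'_ρ m f̂_R(ρ) → Σ'_ρ m f̂(ρ)`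
  (`‖(f - f_R)^(ρ)‖ ≤ 2(τ₀(R)+τ₂(R))/(1+γ²)` by the no-compact-support integration by parts
  `norm_weilMellin_le_of_two_derivs` of `…MellinByParts`, weighted tail norms `τ_j(R) → 0`, and
  `Σ_ρ m(ρ)/(1+γ²) < ∞`, `ZetaZeroSum.summable_zeroOrder_div_one_add_sq`).
* `stub_primeTerm_truncation` (W12b): the prime series of `f` converges absolutely
  (`Σ Λ(n) n^{-1/2-b₀} < ∞`) and `weilPrimeTerm f_R → weilPrimeTerm f`.
* `stub_archPolar_truncation` (W12c): the archimedean integrand `f̂(½+it) Re ψ(¼+it/2)` is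
  integrable (`‖f̂_R(½+it)‖ ≤ D/(1+t²)` uniformly in `R`, `Re ψ(¼+it/2) = O(log(2+|t|))`),
  `weilArchTerm f_R → weilArchTerm f` and `weilPolarTerm f_R → weilPolarTerm f`.
* `stub_archBombieri_truncation` (W12e): the same for Bombieri's form `weilArchTermBombieri`
  (integrand `(e^{h/2}(f(h)+f(-h)) - 2f(0))/(2 sinh h)` integrable on `(0,∞)`; continuity under
  truncation), so that `weilArchTermBombieri f = weilArchTerm f` extends from tests to the class.
* `stub_phi_translate_harmonic` (W13, takes the assembled explicit formula (EF) as hypothesis):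
  every translate `τ_{t₀}Φ = Φ(· + t₀)` lies in the class (all `b₀`) and **`W(τ_{t₀}Φ) = 0`** —
  `(τ_{t₀}Φ)^(s) = e^{-(s-½)t₀} ξ(s)` vanishes at every non-trivial zero, so the zero side is `0`.
* `stub_phi_conv_harmonic` (W14, takes (EF) as hypothesis): **`W(Φ ⋆ g̃) = 0` for every test `g`**
  (`Φ ⋆ g̃` lies in the class; `(Φ ⋆ g̃)^ = ξ · (g̃)^` by Fubini).
Glue below (lead): `explicit_formula_expClass` (EF := W12a ∘ W12b ∘ W12c + `explicit_formula_holds`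
on each truncation + uniqueness of limits), `weilArchTermBombieri_eq_weilArchTerm_expClass` (W12e),
`phi_translate_harmonic`, `phi_conv_harmonic`, and the POINTWISE IDENTITY
`cosh(t₀/2) = weilPrimeTerm (τ_{t₀}Φ) - weilArchTerm (τ_{t₀}Φ)`, i.e.
`cosh(t/2) = Σ_n Λ(n)n^{-½}[Φ(t+log n)+Φ(t-log n)] + (log 4π+γ)Φ(t) + ∫₀^∞[e^{h/2}(Φ(t+h)+Φ(t-h))-2Φ(t)]/(2 sinh h) dh`:
the prime + archimedean Weil operator maps Riemann's kernel to the POLAR eigenfunction `cosh(t/2)`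
(and `∫ Φ cosh(t/2) = (ξ(0)+ξ(1))/2 = ½`), which makes the window truncation `P_aΦ` an exact-up-to-tails
zero-mode of the window Euler–Lagrange operator — the operator form of c2's energy quasimode
`Q(φ_a) ≤ C exp(-(π/2)e^{2(a-1)})` and the input of the Doob / ground-state-transform identity
`Q(Φw) = ½∬ J Φ⊗Φ |w(s)-w(t)|²` (card `xi-kernel-doob-transform`, next wave).
Why this is the crux's business: every clause of the open stub except tightness (T) is a proved
consequence of the crux (c5–c7); what singles out `Φ` among all candidate limits of renormalised
ground states is exactly `LΦ = 0` + `Φ̂ = ξ`; the identity is RH-free and was missing.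

Rev L9 (lead prover-line-stmt-RiemannHypothesis-1527-c7-0, 2026-08-17): **RESHAPE — RH-free
ZERO-SAMPLING wave, same transfer architecture, same open stub.**  The composition
`GroundStatesConvergeToXi_of` is unchanged (one open stub, `stub_tightMomentLimit_real` = A_real,
≥ RH, the lead's, STUCK by design).  Six RH-free registered stubs (ALL LANDED in wave 1: p157040, p156851,
p157012, p157284, p156946, p157069) supply the one analytic input the c6 report named as missing
from the tree — an RH-free SAMPLING INEQUALITY at the zeta zeros for
windowed `L²` functions — and its first payoffs:
* `stub_boxSobolev` (W6a): Sobolev bound on unit boxes of the strip for an entire `F`: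
  `‖F(β+iγ)‖² ≤ 4 ∫_{τ-1}^{τ+1}∫_0^1 (‖F‖² + 2‖F'‖² + ‖F''‖²)` (`β ∈ [0,1]`, `|γ-τ| ≤ ½`).
* `stub_plancherelBudget` (W6b): for `u ∈ L²` vanishing off `[-a,a]`: `û` entire,
  `û^{(n)} = (u tⁿ)^`, and Plancherel on vertical lines `∫ ‖(u tⁿ)^(x+it)‖² dt ≤ 2π a^{2n} eᵃ ‖u‖₂²`
  (`x ∈ [0,1]`).
* `stub_zeroWindowCount` (W6d): ALL non-trivial zeros in a unit window, with multiplicity, are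
  `≤ C log(|τ|+2)` (the tree's count for `Re ρ ≥ ¼` + the reflection `ρ ↦ 1-ρ̄`), and
  `Σ_ρ m(ρ) log(|Im ρ|+2)/‖s-ρ‖² < ∞` for every `s`.
* `stub_zeroSampling` (W6c, takes W6a, W6b, W6d as hypotheses): **the sampling inequality**
  `Σ_ρ m(ρ)‖û(ρ)‖²/log(|Im ρ|+2) ≤ C (1+a²)² eᵃ ‖u‖₂²` for every `u ∈ L²` vanishing off `[-a,a]`.
* `stub_interpolation` (W7, takes W6c's and W6d's conclusions as hypotheses): **the RH-FREE
  sinc-interpolation identity** `ε(a) û(s) = Σ_ρ m(ρ) û(ρ) K_a(s-ρ)` for EVERY ground state at EVERY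
  window and every `s` (c6's W5 without RH: the Tannery majorant is summable by W6c + W6d instead
  of saturation).
* `stub_dirichletEnergy_mul` (W8): smooth bounded multipliers act boundedly on the window's
  pure-jump Dirichlet form, `𝓔_a(wg) ≤ 2‖w‖∞² 𝓔_a(g) + K_a(‖w‖∞² + ‖w'‖∞²)‖g‖₂²` (input of the
  log-free, form-bounded sampling inequality planned for wave 2).
Glue below: `zeroSampling` (W6c ∘ W6a,W6b,W6d), `interpolation_RHfree` (W7 ∘ zeroSampling, W6d),
`order_mul_norm_sq_weilMellin_div_log_le` (RH-free node bound for ground states).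


Rev L8 (lead prover-line-stmt-RiemannHypothesis-1527-c6-0, 2026-08-17): RESHAPE — REAL NORMAL FORM of the
open stub, same transfer architecture.  The open stub A = `stub_tightMomentLimit` of rev L7
((T) tightness ∧ (M) moments along some sequence of ground states, `c_k ≠ 0` complex) is replaced
by `stub_tightMomentLimit_real`: the SAME clauses for REAL-VALUED, EVEN ground states `u_k`
(`u_k(-t) = u_k(t)`, `Im u_k = 0`) and REAL POSITIVE constants `c_k > 0` — the exact object class
of Connes–van Suijlekom Thm 6.1 / de Branges (real even `L²[-a,a]` functions: `U(z) = û(1/2+iz)`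
is a real entire even function of exponential type `a`).  Nothing is lost: RH-free registered
stubs (wave 1) prove `A ⟺ A_real`:
* `stub_rePart_groundState` (W1): the normalised REAL PART of a ground state is a ground state
  (`Q(r₁ + i r₂) = Q(r₁) + Q(r₂)` for real test functions — conjugation + reflection invariance of
  Weil's distribution; then the even-part template of `isWeilGroundState_evenPart`).
* `stub_evenWitness_tight` (W2a): a crux-shaped witness yields an EVEN one with `c_k ≠ 0`, and
  `b`-tightness transfers for every `b` (`c'v = (cu + cu(-·))/2`; c4's `exists_even_cruxWitness` +
  the tightness bookkeeping).
* `stub_realWitness_tight` (W2b, takes W1's statement as hypothesis): an even crux-shaped witness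
  yields a REAL EVEN one with `c_k > 0`, `b`-tightness transferring (`c'v = Re(c u)` pointwise; the
  conjugate witness `conj F_k(conj s) → ξ(s)` by `ξ(conj s) = conj ξ(s)`).
* `stub_energyCauchy` (W3): the minimising sequence of a ground state is CAUCHY IN ENERGY,
  `Re Q(g_n − g_m) → 0` (parallelogram law for `Q`, `ε‖h‖² ≤ Re Q(h)`, `‖g_n + g_m‖² → 4`) — the
  form-domain handle for wave 2 (RH-conditional saturation `Σ_ρ m|û(ρ)|² = ε(a)`; the
  exponential-tested Euler–Lagrange / interpolation identity `ε(a) û(s) = Σ_ρ m û(ρ) 2sinh(a(ρ−s))/(ρ−s)`).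
Composition `GroundStatesConvergeToXi_of`: witness from `stub_tightMomentLimit_real` (cast
`c_k : ℝ` to `ℂ`), convergence clause = `stub_locallyUniform_of_pointwise ∘ stub_pointwise_of_tight_moments`
(landed).  Exactness `tightMomentLimit_real_iff`: `A_real ⟺ A` (⇐: transfer, W2a, W2b∘W1,
`stub_moments_of_strip`).  Hence `A_real ⟺ A ⟺ C⁺ ⟺ (T)-tight crux witness`, all ≥ RH.
Stubs: open `stub_tightMomentLimit_real` (the lead's; STUCK by design, = CCM25 §7 ≥ RH);
wave 1 LANDED all four: W1 p150213, W2a p148663, W2b p149708, W3 p149917; glue `…RealNormalForm` p151207.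
Rev L8b (same day): wave-2 stubs W4 `stub_saturation_of_RH` (RH ⇒ Σ_ρ m|û(ρ)|² = ε(a), equality
in c4's sampling inequality, via W3) and W5 `stub_interpolation_of_RH` (RH ⇒ ε(a)û(s) = Σ_ρ m û(ρ)K_a(s−ρ),
the exponential-tested Euler–Lagrange / sinc-interpolation identity) — BOTH LANDED (p152503, p153869).
Lead's own files: `…RealNormalForm` p151207 (crux ⟺ real even positive-constant crux; A_real ⟺ A;
energy sequence-independence) and `…NegativePart` p151945 (the (T) clause is a POSITIVITY-DEFECT
condition: A_real ⟺ ∃ real even positive crux witness whose NEGATIVE PARTS are tight,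
`tightMomentLimit_real_iff_negPart`; such a witness ⇒ RH).  Rev L8c: one sorry left (A_real).  Literature re-check (c6): Suzuki arXiv:2606.09096 (1.2) is
conjectural as printed; Connes arXiv:2602.04022 Fact 6.4 is for the prolate guess `k_λ` only.

Rev L7 (lead prover-line-stmt-RiemannHypothesis-1527-c5-0, 2026-08-17): **RESHAPE — same
transfer architecture, finer and more verifiable stubs.**  The weak-convergence clause (W) of
the old open stub C⁺ = `stub_tightWeakLimit` is replaced by the MOMENT clause
(M) `∀ n, c_k ∫ u_k(t) tⁿ dt → ∫ Φ(t) tⁿ dt` — position-space scalars, the observables of the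
crux numerics (mean `∫u_a`, width law `W(u_a) → ξ″(½)/ξ(½)`, `Numerics-r1-k2.md`).  Stubs:
* `stub_tightMomentLimit` (OPEN, the lead's; ≥ RH exactly like C⁺): `∃ a_k → ∞`, ground states
  `u_k`, `c_k ≠ 0` with (T) tightness in every `L¹(e^{b|t|})`, `b < 1/2`, and (M).
* `stub_pointwise_of_tight_moments` (RH-free, wave 1 — LANDED p145555): (T) ∧ (M) ⇒ `c_k û_k(σ) → ξ(σ)` for real
  `σ ∈ (0,1)` (expand `e^{(σ−½)t} = Σ (σ−½)ⁿtⁿ/n!` inside the Mellin integral, dominated by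
  `e^{b|t|}`; Tannery in `k` with the geometric majorant `M_b (|σ−½|/b)ⁿ`; the limit series is
  `weilMellin Φ σ = ξ(σ)` by `stub_mellinXi`).  Feeds the LANDED `stub_locallyUniform_of_pointwise`.
* `stub_moments_of_strip` (RH-free, wave 1 — LANDED p145888): the crux's convergence clause ⇒ (M) (locally uniform
  convergence of holomorphic functions gives convergence of all derivatives at `s = ½`,
  `TendstoLocallyUniformlyOn.deriv` iterated; `(c û)^{(n)}(½) = c ∫ u tⁿ`, `ξ^{(n)}(½) = ∫ Φ tⁿ`
  by differentiation under the integral sign).  Not on the composition path: it makes the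
  line EXACT again — `stub_tightMomentLimit ⟺ ∃ (T)-tight crux witness ⟺ C⁺`
  (`tightMomentLimit_iff_tight_cruxWitness` below + `…LineExact` p111371), so every clause of
  the open stub except (T) is now a PROVED consequence of the crux (for (W) this was unknown).

Rev L6 (lead c4): zero side — crux ⇒ RH ∨ {off-line zeros}.Infinite (p140413); zero-side
Euler–Lagrange HasSum (p140908); parity normal form (p141807, p142237); parity-free gap (p142813);
uniqueness suffices (p143674).  Rev L5 (lead c3): renormalisation blow-up (p138483, p138703,
p139145), parity needed only frequently (p138692), bridge gap + quasimode ⇒ C⁺ (p138997).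
Rev L4 (lead c2): C⁺ ⇒ RH unconditionally (p136942); energy side (p136722, p136838).  Rev L3
(lead c1): line exactness (p107010, p111371), hardness at `b₀ = 1/2` (p107648, p111430),
RH ⟺ ε sub-exponential (p108245), geometric windows (p115528).  Rev L2 (lead 0): stubs 1–4
landed (p96310, p97102, p96799, p96428), transfer p97820.  (Full history: `Lines/Sketch.md`.)

CRUX (as filed): `∃ a_k → ∞`, ground states `u_k` of Weil's truncated quadratic form on
`[-a_k, a_k]` (operator-free: `MemLp 2` + `L²`-limit of a normalised minimising sequence of test
functions, verbatim `IsWeilGroundState (a k) (u k)`), and `c_k ≠ 0`, with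
`c_k · weilMellin (u k) → riemannXi` locally uniformly on the open critical strip.

Dictionary (verbatim expansions, no local `def`):
* `Φ`            ↦ `fun t : ℝ => 2 * LagariasMontague.Psic (2 * t)`
* (T) tight      ↦ `∀ b : ℝ, b < 1/2 → ∃ M : ℝ, ∀ k, ∫ t, ‖c k * u k t‖ * Real.exp (b * |t|) ≤ M`
* (M) moments    ↦ `∀ n : ℕ, Tendsto (fun k => c k * ∫ t, u k t * (t : ℂ) ^ n) atTop (𝓝 (∫ t, Φ t * (t : ℂ) ^ n))`
* real part of `u`, normalised ↦ `fun t => (((√(∫ s, ‖((u s).re : ℂ)‖²))⁻¹ : ℝ) : ℂ) * ((u t).re : ℂ)`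
-/

set_option linter.dupNamespace false

noncomputable section

open scoped Topology Real ComplexConjugate ArithmeticFunction.vonMangoldt
open Filter Set MeasureTheory Complex

namespace Summit.RiemannHypothesis.RiemannHypothesis.Cruxes.GroundStatesConvergeToXi.Sketch

open Literature.NumberTheory.LFunctions
open Summit.RiemannHypothesis.RiemannHypothesis.Theorems.GroundStatesConvergeToXi

/-! ### The registered stubs (signatures over existing declarations only) -/

/-- **Stub A_real — `tightMomentLimit_real` (OPEN; LOAD-BEARING; the lead's stub; carries the
RH-content).**  Along some sequence of windows `a_k → ∞` there are REAL-VALUED EVEN ground states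
`u_k` and REAL POSITIVE scalars `c_k` such that the renormalised ground states `c_k u_k` are TIGHT
in every weighted `L¹(e^{b|t|} dt)`, `b < 1/2`, and ALL THEIR MOMENTS converge to those of
Riemann's kernel `Φ(t) = 2Ψ(2t)`.  Equivalent (RH-free, `tightMomentLimit_real_iff`) to the rev-L7
stub `stub_tightMomentLimit`, hence to C⁺ and to "∃ (T)-tight witness of the crux"; it is the
position-space / moment form of CCM25 §7's limit formula (Connes–Consani–Moscovici
arXiv:2511.22755 §7; Suzuki arXiv:2606.09096 (1.2)) for the C–vS object class, and is ≥ RH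
(`riemannHypothesis_of_tightMomentLimit`). -/
theorem stub_tightMomentLimit_real :
    ∃ a : ℕ → ℝ, ∃ u : ℕ → ℝ → ℂ, ∃ c : ℕ → ℝ, Tendsto a atTop atTop ∧ (∀ k, 0 < c k) ∧
      (∀ k, IsWeilGroundState (a k) (u k)) ∧ (∀ k t, u k (-t) = u k t) ∧
      (∀ k t, (u k t).im = 0) ∧
      (∀ b : ℝ, b < 1 / 2 → ∃ M : ℝ, ∀ k, ∫ t, ‖(c k : ℂ) * u k t‖ * Real.exp (b * |t|) ≤ M) ∧
      (∀ n : ℕ, Tendsto (fun k => (c k : ℂ) * ∫ t, u k t * (t : ℂ) ^ n) atTop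
        (𝓝 (∫ t, 2 * LagariasMontague.Psic (2 * t) * (t : ℂ) ^ n))) := by
  sorry

/-! ### Rev L11 stubs (lead c9) — TIGHT WEAK LIMITS OF RENORMALISED GROUND STATES ARE
WEIL-HARMONIC (RH-free), and NON-RIGIDITY of the harmonic class

Card `harmonic-weak-limit-closure`, first lemma `HarmonicWeakLimitClosure`, in full: along windows
`a_k → ∞`, ground states `u_k`, scalars `c_k` with `c_k u_k` bounded in ONE weighted `L¹(e^{b₀|t|})`,
`b₀ > 1/2`, every weak limit `v` (against test functions) satisfies `W(v ⋆ g̃) = 0` for every test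
`g` — hence (rev L10g `harmonic_closure`) `v̂(ρ) = 0` at EVERY non-trivial zero, and (c0/c1
`riemannHypothesis_of_tight_weakLimit_ne_zero`) `v ≠ 0 ⇒ RH`.  Mechanism: the weak Euler–Lagrange
equation `W(u_k ⋆ h̃) = ε(a_k)⟨u_k, h⟩` (H4, from `groundState_eulerLagrange` + continuity of
`f ↦ W(f ⋆ h̃)`), continuity of the Weil functional under dominated pointwise convergence on the
exponential class (H1, H2), the uniform exponential class of `{c_k u_k ⋆ h̃}` and its pointwise
convergence under weak convergence (H3), and the RH-free energy dichotomy `ε → 0 ∨ ε → -∞`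
(`tendsto_weilGroundEnergy_zero_or_atBot`): if `ε → 0` the limit identity reads `W(v ⋆ h̃) = 0·⟨v,h⟩`;
if `ε → -∞` then `¬RH`, so every pairing `⟨c_k u_k, g⟩ → 0` (c0), `v = 0` a.e. and `W(0 ⋆ h̃) = 0`.
H5 removes the integrability hypothesis on `v` (weighted `L¹` norms are weakly lower
semicontinuous); H6 is the NON-RIGIDITY witness: the symmetrised translate
`v_x = (τ_xΦ + τ_{-x}Φ)/2 = Ψ(2(t+x)) + Ψ(2(t-x))` is real, even, positive, Schwartz-exponential,
Weil-harmonic, with `v̂_x = cosh((s-½)x)·ξ(s)` (extra zeros ON the critical line only), and is not a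
multiple of `Φ` for `x ≠ 0` — so harmonicity + parity + positivity + decay + zero location of the
limit do NOT identify `Φ`: the crux's identification step must use finite-window minimality.

Dictionary (inline, no `def`): exponential Weil class as in rev L10 (`ContDiff ℝ ⊤`, envelopes on
`f, deriv f, deriv (deriv f)`); weighted `L¹`: `AEStronglyMeasurable f volume ∧
Integrable (fun t => ‖f t‖ * Real.exp (b₁ * |t|))`; weak convergence against tests:
`∀ g, IsWeilTest g → Tendsto (fun k => ∫ t, f k t * g t) atTop (𝓝 (∫ t, v t * g t))`. -/

-- Wave 1 (six workers, 2026-08-17) — ALL LANDED, imported above (namespace `…Theorems.GroundStatesConvergeToXi`):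
-- H1 `stub_weilArchPolar_dominated` p172765 (`…StubWeilArchPolarDominated.lean`), H2 `stub_weilFunctional_dominated`
-- p172739 (`…StubWeilFunctionalDominated.lean`), H3 `stub_weilConv_pairing` p172812 (`…StubWeilConvPairing.lean`),
-- H4 `stub_groundState_eulerLagrange_strong` p172802 (`…StubGroundStateEulerLagrangeStrong.lean`), H5
-- `stub_weightedL1_of_weakLimit` p173007 (`…StubWeightedL1OfWeakLimit.lean`), H6 `stub_phi_translateAvg_harmonic`
-- p173010 (`…StubPhiTranslateAvgHarmonic.lean`).

-- H7 `stub_weakLimit_harmonic` LANDED (lead file `…WeakLimitHarmonic.lean`, p173191), imported above, together with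
-- `tendsto_weilFunctional_of_dominated` (H2 ∘ H1), `IsWeilGroundState.weilFunctional_eq_energy_mul` (H4: W(u ⋆ h̃) = ε(a)⟨u,h⟩),
-- `weakLimit_harmonic`, `weakLimit_weilMellin_eq_zero`, `weakLimit_harmonic_of_locallyIntegrable`, `weakLimit_dichotomy`,
-- `exists_weilHarmonic_not_const_mul_phi` — used below by name.

/-! ### Rev L10 stubs (lead c8) — the explicit formula for the exponential Weil class
and Weil-harmonicity of Riemann's kernel (all RH-free)

Exponential Weil class (inline, no `def`): `f : ℝ → ℂ` smooth with
`‖f t‖, ‖deriv f t‖, ‖deriv (deriv f) t‖ ≤ C e^{-b₀|t|}`, `b₀ > 1/2`.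
Truncation: `f_R t = f t * cutoff R t` (`Literature.Analysis.Calculus.cutoff`).

Wave 1 (six workers, 2026-08-17) — ALL LANDED, imported above (namespace `…Theorems.GroundStatesConvergeToXi`):
W12a `stub_zeroSide_truncation` p162625 (`…StubZeroSideTruncation.lean`), W12b `stub_primeTerm_truncation`
p163027 (`…StubPrimeTermTruncation.lean`), W12c `stub_archPolar_truncation` p163524
(`…StubArchPolarTruncation.lean`), W12e `stub_archBombieri_truncation` p164017
(`…StubArchBombieriTruncation.lean`), W13 `stub_phi_translate_harmonic` p164438
(`…StubPhiTranslateHarmonic.lean`), W14 `stub_phi_conv_harmonic` p164962 (`…StubPhiConvHarmonic.lean`). -/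

-- W12d `stub_explicit_formula_expClass` LANDED (lead file `…ExpClassHarmonic.lean`, p165459), imported above,
-- together with `explicit_formula_expClass`, `explicit_formula_expClass'`, `weilArchTermBombieri_eq_weilArchTerm_expClass`,
-- `phi_translate_harmonic`, `phi_harmonic`, `phi_conv_harmonic`, `weilPolarTerm_phi_translate`,
-- `weilPrimeTerm_sub_weilArchTerm_phi_translate`, `weilPrimeTerm_sub_weilArchTermBombieri_phi_translate(_phi)`.

/-! ### Rev L10c stubs (wave 2, lead c8) — the DOOB / ground-state-transform identity for
Weil's form conjugated by Riemann's kernel, the explicit formula for Gaussians, the sign of the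
signed Lévy kernel, and the weighted-`L²` transfer of card `xi-kernel-doob-transform` (all RH-free)

Dictionary (inline, no `def`): `Φ t = 2Ψ(2t)` real: `2 * LagariasMontague.Psi (2 * t)`, complex:
`(2 : ℂ) * LagariasMontague.Psic (2 * t)`; the `Φ`-weighted jump energy at lag `h` of `w : ℝ → ℂ`:
`I_w(h) = ∫ t, Φ(t) Φ(t+h) ‖w(t+h) − w(t)‖²`; `g_w(x) = Φ(x) ‖w x‖²`; translate `τ_xΦ = Φ(· + x)`. -/

-- Wave 2 (six workers, 2026-08-17) — ALL LANDED, imported above: D1 `stub_doob_prime` p166952 (`…StubDoobPrime.lean`),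
-- D2 `stub_doob_arch` p167649 (`…StubDoobArch.lean`), D3 `stub_doob_polar` p168407 (`…StubDoobPolar.lean`),
-- E1 `stub_gaussian_expClass` p168741 (`…StubGaussianExpClass.lean`), E3 `stub_doobKernel_sign` p168883
-- (`…StubDoobKernelSign.lean`), E4 `stub_tightWeak_of_weightedL2Limit` p169216 (`…StubTightWeakOfWeightedL2Limit.lean`).






-- Rev L10f (wave 3, lead c8) — ALL LANDED, imported above: G1 `stub_weilGroundEnergy_doob` p169728
-- (`…StubWeilGroundEnergyDoob.lean`), G2 `stub_doob_longRange` p169951 (`…StubDoobLongRange.lean`), G3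
-- `stub_doob_bulkPoincare` p170524 (`…StubDoobBulkPoincare.lean`), G4 `stub_phi_iteratedDeriv_envelope` p170582
-- (`…StubPhiIteratedDerivEnvelope.lean`), G5 `stub_mellin_divide` p170706 (`…StubMellinDivide.lean`).

-- Rev L10g (wave 4, lead c8) — ALL LANDED, imported above: K1 `stub_strongClass_pairing` p170957
-- (`…StubStrongClassPairing.lean`), K2 `stub_mellin_divide_strong` p170885 (`…StubMellinDivideStrong.lean`),
-- K3 `stub_harmonic_extension` p171042 (`…StubHarmonicExtension.lean`), K4 `stub_phi_divide_iterate` p171159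
-- (`…StubPhiDivideIterate.lean`).

-- K5 `stub_harmonic_closure` LANDED (lead file `…HarmonicClosure.lean`, p171260), imported above, with `harmonic_closure`,
-- `strongClass_rate_mono`, `weilMellin_phi_eq_zero_of_mem`.

-- Lead file (c7): `…ZeroSideDefect.lean` p159468 — defect identity `Σ m‖û(ρ)−û(1−ρ̄)‖² = 2Σ m‖û‖² − 2ε(a)`,
-- real even `Σ m û(ρ)² = ε(a)`, `Σ m‖û‖² = ε + 2Σ m(Im û)²`, and the zero-side tightness criterion
-- `riemannHypothesis_of_realEvenCruxWitness_zeroSideTight` (registered stub, landed).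
-- Rev L9c stubs (wave 2, lead c7) — ALL LANDED, imported above: W9 `stub_logPlancherel` p157920
-- (`…StubLogPlancherel.lean`), W10a `stub_logWeightedAssembly` p158128 (`…StubLogWeightedAssembly.lean`),
-- W10b `stub_weightedLineBudget` p158511 (`…StubWeightedLineBudget.lean`), W10c `stub_formBoundedSampling`
-- p158047 (`…StubFormBoundedSampling.lean`), W11a `stub_samplingCauchy` p158243 (`…StubSamplingCauchy.lean`),
-- W11b `stub_zeroSideEnergy` p158322 (`…StubZeroSideEnergy.lean`).

-- Rev L9 stubs (wave 1, lead c7) — ALL LANDED, imported above (namespace `…Theorems.GroundStatesConvergeToXi`):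
-- W6a `stub_boxSobolev` p157040 (`…StubBoxSobolev.lean`), W6b `stub_plancherelBudget` p156851
-- (`…StubPlancherelBudget.lean`), W6d `stub_zeroWindowCount` p157012 (`…StubZeroWindowCount.lean`),
-- W6c `stub_zeroSampling` p157284 (`…StubZeroSampling.lean`), W7 `stub_interpolation` p156946
-- (`…StubInterpolation.lean`), W8 `stub_dirichletEnergy_mul` p157069 (`…StubDirichletEnergyMul.lean`).

-- Stub W4 `stub_saturation_of_RH` LANDED (wave 2): p152503, `…StubSaturationOfRH.lean` (imported above).
-- Stub W5 `stub_interpolation_of_RH` LANDED (wave 2): p153869, `…StubInterpolationOfRH.lean`.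
-- Stub W1 `stub_rePart_groundState` LANDED (wave 1): p150213,
-- `…Theorems/WeilGroundStateGroundStatesConvergeToXiStubRePartGroundState.lean` (imported above).
-- Stub W2a `stub_evenWitness_tight` LANDED (wave 1): p148663, `…StubEvenWitnessTight.lean`.
-- Stub W2b `stub_realWitness_tight` LANDED (wave 1): p149708, `…StubRealWitnessTight.lean`.
-- Stub W3 `stub_energyCauchy` LANDED (wave 1): p149917, `…StubEnergyCauchy.lean`.

-- Landed stubs of earlier revisions (imported above, namespace `…Theorems.GroundStatesConvergeToXi`):
-- `stub_psiDecay` p96310, `stub_mellinXi` p97102, `stub_pointwise_of_weak` p96799,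
-- `stub_locallyUniform_of_pointwise` p96428, `stub_pointwise_of_tight_moments` p145555,
-- `stub_moments_of_strip` p145888.

/-! ### Rev L11 glue (lead c9) — the weak-limit programme after H1–H7 -/

/-- **Tight weak limits of renormalised ground states: the RH-free dichotomy** (re-export of
`weakLimit_dichotomy`, H1–H7): a locally integrable weak limit `v` of a `b₀ > 1/2`-tight sequence
`c_k u_k` (ground states at windows `a_k → ∞`) is either `0` a.e., or RH holds, `ε → 0`, `v` is
Weil-harmonic and `v̂` vanishes at every non-trivial zero. [folklore] -/
theorem weakLimit_dichotomy' {a : ℕ → ℝ} {u : ℕ → ℝ → ℂ} {c : ℕ → ℂ} {v : ℝ → ℂ} {b₀ M : ℝ}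
    (ha : Tendsto a atTop atTop) (hu : ∀ k, IsWeilGroundState (a k) (u k)) (hb₀ : 1 / 2 < b₀)
    (hM : ∀ k, ∫ t, ‖c k * u k t‖ * Real.exp (b₀ * |t|) ≤ M) (hv : LocallyIntegrable v volume)
    (hweak : ∀ g : ℝ → ℂ, IsWeilTest g →
      Tendsto (fun k => ∫ t, c k * u k t * g t) atTop (𝓝 (∫ t, v t * g t))) :
    v =ᵐ[volume] 0 ∨
      (RiemannHypothesis ∧ Tendsto weilGroundEnergy atTop (𝓝 0) ∧
        (∀ g : ℝ → ℂ, IsWeilTest g → weilFunctional (weilConv v (weilReflect g)) = 0) ∧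
        ∀ ρ : ℂ, ρ ∈ ZetaZeros.riemannZetaNontrivialZeros → weilMellin v ρ = 0) :=
  weakLimit_dichotomy ha hu hb₀ hM hv hweak

/-! ### Rev L11b stubs (wave 2, lead c9) — the MELLIN side of the weak-limit programme for a
GENERAL limit (RH-free): `c_k û_k → v̂` locally uniformly on the open strip for every (T)-tight weak
limit `v` (the landed transfer `stub_pointwise_of_weak` / `stub_locallyUniform_of_pointwise` is the
case `v = Φ`, `v̂ = ξ`).  With C–vS (`groundStateMellinRealZeros_proof`) and Hurwitz this gives the
HURWITZ SIGNATURE of non-zero tight limits under `GroundStateSimpleEven`: `v̂` is zero-free off the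
critical line inside the strip (lead glue). -/

-- Wave 2 (two workers, 2026-08-17) — BOTH LANDED, imported above: M1 `stub_weakLimit_mellin_pointwise` p173612
-- (`…StubWeakLimitMellinPointwise.lean`), M2 `stub_weakLimit_mellin_locallyUniform` p173580
-- (`…StubWeakLimitMellinLocallyUniform.lean`).

-- M3 `stub_weakLimit_hurwitz` LANDED (lead file `…WeakLimitMellin.lean`, p173883), imported above, together with
-- `weakLimit_mellin_locallyUniform` (M2 ∘ M1: `c_k û_k → v̂` locally uniformly for tight weak limits),
-- `ae_eq_zero_of_weilMellin_criticalLine` (Mellin uniqueness), `weakLimit_hurwitz` (Hurwitz signature under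
-- `GroundStateSimpleEven`), `groundStatesConvergeToXi_of_weakLimit_const_mul_phi` (NV × IDENT ⇒ crux).

/-! ### Rev L11c stub (wave 3, lead c9) — EXISTENCE of weak limits (RH-free functional analysis):
weak sequential compactness of bounded sets of `L²(ℝ)` in the tree's test-pairing language, so that the
dichotomy/trichotomy for renormalised ground states with BOUNDED constants needs no "let v be a weak
limit" hypothesis. -/

/-- **Stub C1 — `weakL2_compact` (RH-free; wave 3).**  Every `L²`-bounded sequence of functions on
`ℝ` has a subsequence converging weakly to an `L²` function: `∫ f_{φ(k)} g → ∫ v g` for every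
`g ∈ L²` (Banach–Alaoglu in the separable Hilbert space `L²(ℝ)`: `WeakDual.isSeqCompact_closedBall`,
`Lp.SecondCountableTopology`, Riesz `InnerProductSpace.toDual`, `L2.inner_def`). [folklore] -/
theorem stub_weakL2_compact :
    ∀ (f : ℕ → ℝ → ℂ) (B : ℝ), (∀ k, MemLp (f k) 2 volume) → (∀ k, ∫ t, ‖f k t‖ ^ 2 ≤ B) →
      ∃ φ : ℕ → ℕ, StrictMono φ ∧ ∃ v : ℝ → ℂ, MemLp v 2 volume ∧
        ∀ g : ℝ → ℂ, MemLp g 2 volume →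
          Tendsto (fun k => ∫ t, f (φ k) t * g t) atTop (𝓝 (∫ t, v t * g t)) := by
  sorry



-- `groundStatesConvergeToXi_of_weakLimit_const_mul_phi` (NV × IDENT ⇒ crux: a `b₀>1/2`-tight sequence converging
-- weakly to a NON-ZERO MULTIPLE `m·Φ` gives the crux after rescaling by `m⁻¹`) lives in the lead file
-- `…WeakLimitHarmonic.lean` (appended, rev L11b) — kept out of this skeleton because the checker takes the first
-- crux-concluding theorem as the composition.

/-! ### The composition (sorry-free glue; concludes the crux BY NAME) -/

/-- **Transfer, moment route (RH-free): (T) ∧ (M) ⇒ the crux's convergence clause.**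
Pointwise convergence on `(0,1)` from `stub_pointwise_of_tight_moments`, then Vitali
(`stub_locallyUniform_of_pointwise`, landed p96428). -/
theorem tendstoLocallyUniformlyOn_of_tight_of_moments
    {a : ℕ → ℝ} {u : ℕ → ℝ → ℂ} {c : ℕ → ℂ}
    (hu : ∀ k, IsWeilGroundState (a k) (u k))
    (htight : ∀ b : ℝ, b < 1 / 2 → ∃ M : ℝ, ∀ k, ∫ t, ‖c k * u k t‖ * Real.exp (b * |t|) ≤ M)
    (hmom : ∀ n : ℕ, Tendsto (fun k => c k * ∫ t, u k t * (t : ℂ) ^ n) atTop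
      (𝓝 (∫ t, 2 * LagariasMontague.Psic (2 * t) * (t : ℂ) ^ n))) :
    TendstoLocallyUniformlyOn (fun k s => c k * weilMellin (u k) s) riemannXi atTop
      {s : ℂ | 0 < s.re ∧ s.re < 1} :=
  stub_locallyUniform_of_pointwise hu htight (stub_pointwise_of_tight_moments hu htight hmom)

/-- **Transfer, weak route (RH-free, fully proved since rev L2): (T) ∧ (W) ⇒ the crux's
convergence clause** (stubs 1–4 composed: `Φ̂ = ξ`, cutoff/tails to the real segment `(0,1)`,
Vitali).  Kept as the alternative entrance to the line. -/
theorem tendstoLocallyUniformlyOn_of_tight_of_weak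
    {a : ℕ → ℝ} {u : ℕ → ℝ → ℂ} {c : ℕ → ℂ}
    (hu : ∀ k, IsWeilGroundState (a k) (u k))
    (htight : ∀ b : ℝ, b < 1 / 2 → ∃ M : ℝ, ∀ k, ∫ t, ‖c k * u k t‖ * Real.exp (b * |t|) ≤ M)
    (hweak : ∀ g : ℝ → ℂ, IsWeilTest g →
      Tendsto (fun k => ∫ t, c k * u k t * g t) atTop
        (𝓝 (∫ t, 2 * LagariasMontague.Psic (2 * t) * g t))) :
    TendstoLocallyUniformlyOn (fun k s => c k * weilMellin (u k) s) riemannXi atTop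
      {s : ℂ | 0 < s.re ∧ s.re < 1} :=
  stub_locallyUniform_of_pointwise hu htight fun σ hσ =>
    stub_pointwise_of_weak stub_psiDecay.1 stub_psiDecay.2
      (stub_mellinXi stub_psiDecay.1 stub_psiDecay.2) hu htight hweak σ hσ

/-- **Real normal form of tight crux witnesses (RH-free modulo W1, W2a, W2b).**  A `(T)`-tight
crux-shaped witness yields a `(T)`-tight crux-shaped witness with REAL-VALUED EVEN ground states
and REAL POSITIVE constants. -/
theorem exists_real_even_tight_cruxWitness {a : ℕ → ℝ} {u : ℕ → ℝ → ℂ} {c : ℕ → ℂ}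
    (ha : Tendsto a atTop atTop) (hu : ∀ k, IsWeilGroundState (a k) (u k))
    (htight : ∀ b : ℝ, b < 1 / 2 → ∃ M : ℝ, ∀ k, ∫ t, ‖c k * u k t‖ * Real.exp (b * |t|) ≤ M)
    (hlim : TendstoLocallyUniformlyOn (fun k s => c k * weilMellin (u k) s) riemannXi atTop
      {s : ℂ | 0 < s.re ∧ s.re < 1}) :
    ∃ a' : ℕ → ℝ, ∃ v : ℕ → ℝ → ℂ, ∃ c' : ℕ → ℝ, Tendsto a' atTop atTop ∧ (∀ k, 0 < c' k) ∧
      (∀ k, IsWeilGroundState (a' k) (v k)) ∧ (∀ k t, v k (-t) = v k t) ∧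
      (∀ k t, (v k t).im = 0) ∧
      (∀ b : ℝ, b < 1 / 2 → ∃ M : ℝ, ∀ k, ∫ t, ‖(c' k : ℂ) * v k t‖ * Real.exp (b * |t|) ≤ M) ∧
      TendstoLocallyUniformlyOn (fun k s => (c' k : ℂ) * weilMellin (v k) s) riemannXi atTop
        {s : ℂ | 0 < s.re ∧ s.re < 1} := by
  obtain ⟨a₁, v₁, c₁, ha₁, -, hv₁, hev₁, ht₁, hlim₁⟩ := stub_evenWitness_tight a u c ha hu hlim
  obtain ⟨a₂, v₂, c₂, ha₂, hc₂, hv₂, hev₂, hre₂, ht₂, hlim₂⟩ :=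
    stub_realWitness_tight stub_rePart_groundState a₁ v₁ c₁ ha₁ hv₁ hev₁ hlim₁
  exact ⟨a₂, v₂, c₂, ha₂, hc₂, hv₂, hev₂, hre₂, fun b hb => ht₂ b (ht₁ b (htight b hb)), hlim₂⟩

/-- **Line exactness (RH-free modulo landed stubs): the rev-L7 open stub is EXACTLY "a (T)-tight
witness of the crux".**  (⇒) transfer by moments; (⇐) `stub_moments_of_strip`. -/
theorem tightMomentLimit_iff_tight_cruxWitness :
    (∃ a : ℕ → ℝ, ∃ u : ℕ → ℝ → ℂ, ∃ c : ℕ → ℂ, Tendsto a atTop atTop ∧ (∀ k, c k ≠ 0) ∧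
      (∀ k, IsWeilGroundState (a k) (u k)) ∧
      (∀ b : ℝ, b < 1 / 2 → ∃ M : ℝ, ∀ k, ∫ t, ‖c k * u k t‖ * Real.exp (b * |t|) ≤ M) ∧
      (∀ n : ℕ, Tendsto (fun k => c k * ∫ t, u k t * (t : ℂ) ^ n) atTop
        (𝓝 (∫ t, 2 * LagariasMontague.Psic (2 * t) * (t : ℂ) ^ n)))) ↔
    (∃ a : ℕ → ℝ, ∃ u : ℕ → ℝ → ℂ, ∃ c : ℕ → ℂ, Tendsto a atTop atTop ∧ (∀ k, c k ≠ 0) ∧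
      (∀ k, IsWeilGroundState (a k) (u k)) ∧
      (∀ b : ℝ, b < 1 / 2 → ∃ M : ℝ, ∀ k, ∫ t, ‖c k * u k t‖ * Real.exp (b * |t|) ≤ M) ∧
      TendstoLocallyUniformlyOn (fun k s => c k * weilMellin (u k) s) riemannXi atTop
        {s : ℂ | 0 < s.re ∧ s.re < 1}) := by
  constructor
  · rintro ⟨a, u, c, ha, hc, hu, htight, hmom⟩
    exact ⟨a, u, c, ha, hc, hu, htight, tendstoLocallyUniformlyOn_of_tight_of_moments hu htight hmom⟩
  · rintro ⟨a, u, c, ha, hc, hu, htight, hlim⟩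
    exact ⟨a, u, c, ha, hc, hu, htight, stub_moments_of_strip hu hlim⟩

/-- **Rev L8 exactness (RH-free modulo W1, W2a, W2b): the REAL NORMAL FORM loses nothing —
`A_real ⟺ A`.**  (⇒) cast the constants; (⇐) transfer by moments to a tight crux witness, real
even normal form (`exists_real_even_tight_cruxWitness`), moments back by `stub_moments_of_strip`. -/
theorem tightMomentLimit_real_iff :
    (∃ a : ℕ → ℝ, ∃ u : ℕ → ℝ → ℂ, ∃ c : ℕ → ℝ, Tendsto a atTop atTop ∧ (∀ k, 0 < c k) ∧
      (∀ k, IsWeilGroundState (a k) (u k)) ∧ (∀ k t, u k (-t) = u k t) ∧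
      (∀ k t, (u k t).im = 0) ∧
      (∀ b : ℝ, b < 1 / 2 → ∃ M : ℝ, ∀ k, ∫ t, ‖(c k : ℂ) * u k t‖ * Real.exp (b * |t|) ≤ M) ∧
      (∀ n : ℕ, Tendsto (fun k => (c k : ℂ) * ∫ t, u k t * (t : ℂ) ^ n) atTop
        (𝓝 (∫ t, 2 * LagariasMontague.Psic (2 * t) * (t : ℂ) ^ n)))) ↔
    (∃ a : ℕ → ℝ, ∃ u : ℕ → ℝ → ℂ, ∃ c : ℕ → ℂ, Tendsto a atTop atTop ∧ (∀ k, c k ≠ 0) ∧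
      (∀ k, IsWeilGroundState (a k) (u k)) ∧
      (∀ b : ℝ, b < 1 / 2 → ∃ M : ℝ, ∀ k, ∫ t, ‖c k * u k t‖ * Real.exp (b * |t|) ≤ M) ∧
      (∀ n : ℕ, Tendsto (fun k => c k * ∫ t, u k t * (t : ℂ) ^ n) atTop
        (𝓝 (∫ t, 2 * LagariasMontague.Psic (2 * t) * (t : ℂ) ^ n)))) := by
  constructor
  · rintro ⟨a, u, c, ha, hc, hu, -, -, htight, hmom⟩
    exact ⟨a, u, fun k => (c k : ℂ), ha, fun k => Complex.ofReal_ne_zero.2 (hc k).ne', hu,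
      htight, hmom⟩
  · rintro ⟨a, u, c, ha, -, hu, htight, hmom⟩
    obtain ⟨a', v, c', ha', hc', hv, hev, hre, ht', hlim'⟩ :=
      exists_real_even_tight_cruxWitness ha hu htight
        (tendstoLocallyUniformlyOn_of_tight_of_moments hu htight hmom)
    exact ⟨a', v, c', ha', hc', hv, hev, hre, ht', stub_moments_of_strip hv hlim'⟩

/-- **The open stub is ≥ RH** (RH-free modulo W1, W2a, W2b: through `tightMomentLimit_real_iff`,
the rev-L7 equivalence with C⁺, and `riemannHypothesis_of_tightWeakLimit`, p136942). -/
theorem riemannHypothesis_of_tightMomentLimit_real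
    (h : ∃ a : ℕ → ℝ, ∃ u : ℕ → ℝ → ℂ, ∃ c : ℕ → ℝ, Tendsto a atTop atTop ∧ (∀ k, 0 < c k) ∧
      (∀ k, IsWeilGroundState (a k) (u k)) ∧ (∀ k t, u k (-t) = u k t) ∧
      (∀ k t, (u k t).im = 0) ∧
      (∀ b : ℝ, b < 1 / 2 → ∃ M : ℝ, ∀ k, ∫ t, ‖(c k : ℂ) * u k t‖ * Real.exp (b * |t|) ≤ M) ∧
      (∀ n : ℕ, Tendsto (fun k => (c k : ℂ) * ∫ t, u k t * (t : ℂ) ^ n) atTop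
        (𝓝 (∫ t, 2 * LagariasMontague.Psic (2 * t) * (t : ℂ) ^ n)))) :
    RiemannHypothesis := by
  obtain ⟨a, u, c, ha, hc, hu, htight, hmom⟩ := tightMomentLimit_real_iff.1 h
  exact riemannHypothesis_of_tightWeakLimit (tightWeakLimit_iff_tight_cruxWitness.2
    ⟨a, u, c, ha, hc, hu, htight, tendstoLocallyUniformlyOn_of_tight_of_moments hu htight hmom⟩)

/-- **The form-domain handle is available for every ground state** (RH-free modulo W3): the
minimising sequence packaged in `IsWeilGroundState a u` is Cauchy in energy. -/
theorem exists_minimizingSeq_energyCauchy {a : ℝ} {u : ℝ → ℂ} (hu : IsWeilGroundState a u) :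
    ∃ g : ℕ → ℝ → ℂ,
      (∀ n, IsWeilTest (g n) ∧ tsupport (g n) ⊆ Icc (-a) a ∧ ∫ t, ‖g n t‖ ^ 2 = (1 : ℝ)) ∧
      Tendsto (fun n => (weilQuadratic (g n)).re) atTop (𝓝 (weilGroundEnergy a)) ∧
      Tendsto (fun n => ∫ t, ‖g n t - u t‖ ^ 2) atTop (𝓝 0) ∧
      Tendsto (fun p : ℕ × ℕ => (weilQuadratic (g p.1 - g p.2)).re) atTop (𝓝 0) := by
  obtain ⟨hmem, g, hg, hQ, hL⟩ := hu
  exact ⟨g, hg, hQ, hL, stub_energyCauchy a u g hmem hg hQ hL⟩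

/-- **Node values of a ground state (RH-conditional modulo W4): every single zero carries at
most the ground energy**, with the saturation identity making the bound an equality in sum:
`m(ρ)|û(ρ)|² ≤ Σ = ε(a)`. -/
theorem order_mul_norm_sq_weilMellin_le_of_RH (hRH : RiemannHypothesis) {a : ℝ} {u : ℝ → ℂ}
    (hu : IsWeilGroundState a u) (ρ : ZetaZeros.riemannZetaNontrivialZeros) :
    (riemannZetaZeroOrder (ρ : ℂ) : ℝ) * ‖weilMellin u ρ‖ ^ 2 ≤ weilGroundEnergy a := by
  have h := stub_saturation_of_RH hRH a u hu
  refine le_hasSum h ρ fun ρ' _ => mul_nonneg ?_ (sq_nonneg _)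
  exact_mod_cast riemannZetaZeroOrder_nonneg (ZetaZeros.riemannZetaNontrivialZeros.ne_one ρ'.2)

/-! ### Rev L9 glue (RH-free zero sampling) -/

/-- **The RH-free sampling inequality at the zeta zeros** (W6c ∘ W6a, W6b, W6d):
`Σ_ρ m(ρ)‖û(ρ)‖²/log(|Im ρ|+2) ≤ C(1+a²)²eᵃ‖u‖₂²` for every `u ∈ L²` vanishing off `[-a,a]`. -/
theorem zeroSampling :
    ∃ C : ℝ, 0 < C ∧ ∀ (a : ℝ) (u : ℝ → ℂ), 0 < a → MemLp u 2 volume →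
      (∀ᵐ t : ℝ, t ∉ Icc (-a) a → u t = 0) →
        Summable (fun ρ : ZetaZeros.riemannZetaNontrivialZeros =>
          (riemannZetaZeroOrder (ρ : ℂ) : ℝ) * ‖weilMellin u ρ‖ ^ 2 / Real.log (|(ρ : ℂ).im| + 2)) ∧
        ∑' ρ : ZetaZeros.riemannZetaNontrivialZeros,
            (riemannZetaZeroOrder (ρ : ℂ) : ℝ) * ‖weilMellin u ρ‖ ^ 2 / Real.log (|(ρ : ℂ).im| + 2) ≤
          C * (1 + a ^ 2) ^ 2 * Real.exp a * ∫ y : ℝ, ‖u y‖ ^ 2 :=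
  stub_zeroSampling stub_boxSobolev stub_plancherelBudget stub_zeroWindowCount

/-- **The RH-free interpolation identity** (W7 ∘ W6c, W6d): for EVERY ground state `u` at EVERY
window `a` and every `s : ℂ`, `ε(a) û(s) = Σ_ρ m(ρ) û(ρ) K_a(s - ρ)`, absolutely convergent. -/
theorem interpolation_RHfree {a : ℝ} {u : ℝ → ℂ} (hu : IsWeilGroundState a u) (s : ℂ) :
    HasSum (fun ρ : ZetaZeros.riemannZetaNontrivialZeros =>
        (riemannZetaZeroOrder (ρ : ℂ) : ℂ) *
          (weilMellin u ρ * ∫ x in Icc (-a) a, cexp ((s - (ρ : ℂ)) * x)))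
      ((weilGroundEnergy a : ℂ) * weilMellin u s) :=
  stub_interpolation zeroSampling stub_zeroWindowCount.2 a u s hu

/-- **RH-free node bound for ground states**: a single zero carries at most the whole sampling
budget, `m(ρ)‖û(ρ)‖² ≤ C(1+a²)²eᵃ · log(|Im ρ|+2)` (`‖u‖₂ = 1`). -/
theorem order_mul_norm_sq_weilMellin_le_log {a : ℝ} {u : ℝ → ℂ} (hu : IsWeilGroundState a u) :
    ∃ C : ℝ, 0 < C ∧ ∀ ρ : ZetaZeros.riemannZetaNontrivialZeros,
      (riemannZetaZeroOrder (ρ : ℂ) : ℝ) * ‖weilMellin u ρ‖ ^ 2 ≤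
        C * (1 + a ^ 2) ^ 2 * Real.exp a * Real.log (|(ρ : ℂ).im| + 2) := by
  obtain ⟨C, hC, h⟩ := zeroSampling
  obtain ⟨hs, hle⟩ := h a u hu.pos hu.memLp hu.ae_eq_zero_of_notMem
  refine ⟨C, hC, fun ρ => ?_⟩
  have hlog : 0 < Real.log (|(ρ : ℂ).im| + 2) := Real.log_pos (by linarith [abs_nonneg (ρ : ℂ).im])
  have hnn : ∀ ρ' : ZetaZeros.riemannZetaNontrivialZeros, 0 ≤
      (riemannZetaZeroOrder (ρ' : ℂ) : ℝ) * ‖weilMellin u ρ'‖ ^ 2 / Real.log (|(ρ' : ℂ).im| + 2) :=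
    fun ρ' => div_nonneg (mul_nonneg (by
      exact_mod_cast riemannZetaZeroOrder_nonneg (ZetaZeros.riemannZetaNontrivialZeros.ne_one ρ'.2))
      (sq_nonneg _)) (Real.log_nonneg (by linarith [abs_nonneg (ρ' : ℂ).im]))
  have h1 := (le_hasSum hs.hasSum ρ fun ρ' _ => hnn ρ').trans hle
  rw [hu.integral_norm_sq, mul_one] at h1
  rwa [div_le_iff₀ hlog] at h1

/-! ### Rev L9c glue (wave 2 — all six stubs LANDED) -/

/-- **Form-bounded (log-free) sampling at the zeros** (W10c ∘ W10a, W10b ∘ W9). -/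
theorem formBoundedSampling :
    ∀ a : ℝ, 0 < a → ∃ A B : ℝ, 0 ≤ A ∧ 0 ≤ B ∧ ∀ g : ℝ → ℂ, IsWeilTest g →
      tsupport g ⊆ Icc (-a) a →
        Summable (fun ρ : ZetaZeros.riemannZetaNontrivialZeros =>
          (riemannZetaZeroOrder (ρ : ℂ) : ℝ) * ‖weilMellin g ρ‖ ^ 2) ∧
        ∑' ρ : ZetaZeros.riemannZetaNontrivialZeros,
            (riemannZetaZeroOrder (ρ : ℂ) : ℝ) * ‖weilMellin g ρ‖ ^ 2 ≤
          A * (weilQuadratic g).re + B * ∫ t : ℝ, ‖g t‖ ^ 2 :=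
  stub_formBoundedSampling stub_logWeightedAssembly (stub_weightedLineBudget stub_logPlancherel)

/-- **RH-free zero-side energy identity for every ground state** (W11b ∘ W11a ∘ W10c):
`Σ_ρ m(ρ) û(ρ) conj û(1−ρ̄) = ε(a)`. -/
theorem zeroSideEnergy {a : ℝ} {u : ℝ → ℂ} (hu : IsWeilGroundState a u) :
    HasSum (fun ρ : ZetaZeros.riemannZetaNontrivialZeros =>
        (riemannZetaZeroOrder (ρ : ℂ) : ℂ) *
          (weilMellin u ρ * (starRingEnd ℂ) (weilMellin u (1 - (starRingEnd ℂ) (ρ : ℂ)))))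
      ((weilGroundEnergy a : ℝ) : ℂ) :=
  stub_zeroSideEnergy (stub_samplingCauchy formBoundedSampling) a u hu

/-- **Log-free square-summability of the zero samples of a ground state (RH-free)**:
`Σ_ρ m(ρ)‖û(ρ)‖² < ∞` (W11a). -/
theorem summable_order_mul_norm_sq_weilMellin {a : ℝ} {u : ℝ → ℂ} (hu : IsWeilGroundState a u) :
    Summable (fun ρ : ZetaZeros.riemannZetaNontrivialZeros =>
      (riemannZetaZeroOrder (ρ : ℂ) : ℝ) * ‖weilMellin u ρ‖ ^ 2) := by
  obtain ⟨hmem, g, hg, hQ, hL⟩ := hu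
  exact (stub_samplingCauchy formBoundedSampling a u g ⟨hmem, g, hg, hQ, hL⟩ hg hQ hL).1

/-! ### Rev L10 glue (lead c8) — LANDED in `…ExpClassHarmonic.lean` (p165459): `isWeilTest_mul_cutoff`,
`explicit_formula_expClass` (EF), `explicit_formula_expClass'`, `explicit_formula_expClass_bombieri`,
`weilArchTermBombieri_eq_weilArchTerm_expClass`, `phi_translate_harmonic`, `phi_harmonic`, `phi_conv_harmonic`,
`weilMellin_phi_conv_weilReflect`, `weilPolarTerm_phi_translate`, `weilPrimeTerm_sub_weilArchTerm_phi_translate`,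
`weilPrimeTerm_sub_weilArchTermBombieri_phi_translate`, `weilPrimeTerm_sub_weilArchTermBombieri_phi` — used below by name. -/

-- D4 `stub_doob_identity` LANDED (lead file `…DoobIdentity.lean`, p169381), imported above, together with
-- `doob_identity`, `doobJumpEnergy_nonneg`, `doobKernel_pos/neg/neg_log`, `groundStatesConvergeToXi_of_weightedL2Limit`
-- (weighted-L² convergence to Φ ⇒ the crux; kept out of this skeleton because the checker takes the first
-- crux-concluding theorem as the composition) and `explicit_formula_gaussian`.

/-! ### Rev L10g glue (lead c8) — LANDED in `…HarmonicClosure.lean` (p171260): `harmonic_closure`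
(measurable `v`, `∫‖v‖e^{b₁|t|} < ∞`, `b₁ > 1/2`, `W(v ⋆ g̃) = 0 ∀ tests g` ⇒ `weilMellin v ρ = 0` at every
non-trivial zero), `stub_harmonic_closure`, `strongClass_rate_mono`, `weilMellin_phi_eq_zero_of_mem`. -/

/-- The closure at work on a Weil-harmonic weighted-`L¹` function (re-export by name, RH-free). [folklore] -/
theorem harmonic_closure' {v : ℝ → ℂ} {b₁ : ℝ} (hv : AEStronglyMeasurable v volume)
    (hb₁ : 1 / 2 < b₁) (hint : Integrable (fun t : ℝ => ‖v t‖ * Real.exp (b₁ * |t|)))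
    (hharm : ∀ g : ℝ → ℂ, IsWeilTest g → weilFunctional (weilConv v (weilReflect g)) = 0)
    {ρ₀ : ℂ} (hρ₀ : ρ₀ ∈ ZetaZeros.riemannZetaNontrivialZeros) :
    weilMellin v ρ₀ = 0 :=
  harmonic_closure hv hb₁ hint hharm hρ₀

-- The interpolation identity `stub_interpolation_of_RH` (W5, p153869) lives in
-- `…Theorems/WeilGroundStateGroundStatesConvergeToXiStubInterpolationOfRH.lean`; it is not on the
-- composition path and is deliberately not imported here (keeps the skeleton's closure small).

/-- **The crux from the stubs.** Take `(a, u, c)` from `stub_tightMomentLimit_real` (constants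
cast to `ℂ`, non-zero since positive); the window clause `0 < a k ∧ c k ≠ 0 ∧ MemLp (u k) 2 ∧ ∃ g, …`
is `IsWeilGroundState (a k) (u k)` unfolded (`IsWeilGroundState.pos`, `.1`, `.2`); locally
uniform convergence on the strip is `tendstoLocallyUniformlyOn_of_tight_of_moments`. -/
theorem GroundStatesConvergeToXi_of :
    Summit.RiemannHypothesis.RiemannHypothesis.Theses.WeilGroundState.GroundStatesConvergeToXi := by
  obtain ⟨a, u, c, ha, hc, hu, -, -, htight, hmom⟩ := stub_tightMomentLimit_real
  exact ⟨a, u, fun k => (c k : ℂ), ha,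
    fun k => ⟨(hu k).pos, Complex.ofReal_ne_zero.2 (hc k).ne', (hu k).1, (hu k).2⟩,
    tendstoLocallyUniformlyOn_of_tight_of_moments hu htight hmom⟩

end Summit.RiemannHypothesis.RiemannHypothesis.Cruxes.GroundStatesConvergeToXi.Sketch

end
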